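import Summits.BirchSwinnertonDyer.BirchSwinnertonDyer.Theorems.KolyvaginRankRigidityAtTwoKolyvaginSwapComposition
import Summits.BirchSwinnertonDyer.BirchSwinnertonDyer.Theorems.KolyvaginRankRigidityAtTwoFullClassDeepeningAtTwoOfProp37
import HarnessLib

/-!
# Crux U1 `KolyvaginBoundedDefectAtTwo` (stmt-BirchSwinnertonDyer-28083), LINE 17 `kolyvagin_swap` — THE CONVERSES:
# U1 ⟹ S0ʳ (room seed) and U1 ⟹ S0⁺ (deep seed); hence S0⁺ ⟺ U1 in the kernel and S0ʳ ⟺ U1 modulo Gross 1991 Prop. 3.7 (2)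

Width seat `bsd-line-krr2-p2` g21 (ONE READER on LINE 17; route `KolyvaginRankRigidityAtTwo`);
`--supports stmt-BirchSwinnertonDyer-28083` (helper).  THEOREMS ONLY; no definitions.

The line's two `@[conjecture]` obligation nodes (`…Theorems.KolyvaginRankRigidityAtTwoKolyvaginSwapDefs`, p736848) are
`KolyvaginRoomSeedAtTwo` (S0ʳ: Kolyvagin's conjecture at `2` in Kolyvagin's VISIBLE `k(r)`-form — a depth `r` such that for every
room `k` some class `c_M(n)` of depth `r` at SOME level `1 ≤ M ≤ M(n)` has visible order `> 2^k`) and `DeepSeedAtTwo` (S0⁺: ONE level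
`M₁` carrying `c_{M₁}(n) ≠ 0` on conductors of unbounded index).  The tree already holds the two FORWARD arrows
`KolyvaginSwap.boundedDefect_of_deepSeed : DeepSeedAtTwo → U1` (vertical growth, p755193) and
`KolyvaginSwap.kolyvaginBoundedDefectAtTwo_of_roomSeed_of_frobeniusCongruence : S0ʳ → P372 → U1` (the line's swap machinery,
p755241).  This file proves the two CONVERSES, both unconditional and both short:

* `roomSeed_of_boundedDefect : U1 → S0ʳ` — at level `M = m + k + 2` the crux gives `2^(k+1)·c_M(n) ≠ 0`; if `2^k·[c_M(n), ρ] = 0` for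
  every `ρ ∈ Γ_{K(E[2^M])}` then `2^k·c_M(n)` vanishes on `Γ_{K(E[2^M])}` (`h1Eval_zsmul`) and Sah's ONE-BIT inflation defect on the
  habitat (`KolyvaginLowerBoundAtTwo.inflationDefect_one_of_hasSurjectiveModNGaloisRep` at `M' = M`: the scalar `−1 ∈ ρ(Γ_K)` kills
  `H¹(K(E[2^M])/K, E[2^M])` up to the factor `2`) gives `2·2^k·c_M(n) = 0`, a contradiction;
* `deepSeed_of_boundedDefect : U1 → S0⁺` — with `M₁ := m + 1`, at level `M* ≥ M₁` the crux gives `2^(M*−M₁)·c_{M*}(n) ≠ 0` with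
  `M* ≤ M(n)`, and McCallum's level link read downwards `M* − M₁` times (`KolyvaginLowerBoundAtTwo.globalOrderLevelDownAtTwo`,
  iterated here as `pow_zsmul_kolyvaginClass_ne_zero_of_levelUp`) gives `c_{M₁}(n) ≠ 0`.

Consequences recorded: `deepSeedAtTwo_iff_boundedDefect : DeepSeedAtTwo ↔ U1` (kernel, unconditional — the Defs docstring's «a READING
of the crux, not a weakening» is now a theorem) and `roomSeedAtTwo_iff_boundedDefect_of_frobeniusCongruence (h37) : S0ʳ ↔ U1`
(modulo the ONE print fact P372 = `GrossLMS1991.prop37_2_frobeniusCongruence`, which enters only through the forward arrow).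
READING (route-shape information for the planner/director, not a ruling): as a ledger node S0ʳ would be a RESTATEMENT of U1 modulo
P372 — same logical strength, no witness of weakness can exist; LINE 17's theorem is the EQUIVALENCE «visible `k(r)`-form at any
level ≡ bounded-defect exponent form», i.e. it moves the difficulty of Kolyvagin's conjecture at `2` into the currency in which a
seed might be found, not below it.  HONEST FRAMING: U1, S0ʳ, S0⁺ are all OPEN (beyond print at `2`); nothing here proves any of them;
no stub of the registered skeleton is closed; no rung; **BSD is NOT proved.**
References (locators only): [cite: Kolyvagin1991MathAnn, §2 (2.1), Conj. 2.5 and the k(r) remark] [cite: Sah1968, Prop. 2.7 (b)]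
[cite: McCallumLMS1991, §4 (4)–(6), Lemma 4.6] [cite: GrossLMS1991, §3 Prop. 3.7 (2), §9].
Design: no definitions; default heartbeats; axioms `propext`, `Classical.choice`, `Quot.sound`.
-/

set_option autoImplicit false
-- the Theorems namespace of this sub repeats the summit name by design (D-0017 nested layout)
set_option linter.dupNamespace false

noncomputable section

open WeierstrassCurve NumberField Field
open Literature.NumberTheory.GaloisRepresentations Literature.NumberTheory.EllipticCurves Literature.NumberTheory
open Literature.NumberTheory.EllipticCurves.ModularForms
open Summit.BirchSwinnertonDyer.BirchSwinnertonDyer.Theses.KolyvaginRankRigidityAtTwo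
open Summit.BirchSwinnertonDyer.BirchSwinnertonDyer.Theorems

namespace Summit.BirchSwinnertonDyer.BirchSwinnertonDyer.Theorems.KolyvaginAtTwo.KolyvaginSwap

/-! ## §1 McCallum's level link read downwards, iterated -/

/-- **`2^(i+j)·c_{M+j}(n) ≠ 0 ⇒ 2^i·c_M(n) ≠ 0`** on U1's habitat, for a square-free Kolyvagin conductor `n` at `2` with `M + j ≤ M(n)`:
`j` applications of the one-step level link `ι_* c_M(n) = 2·c_{M+1}(n)` read downwards
(`KolyvaginLowerBoundAtTwo.globalOrderLevelDownAtTwo`). [cite: McCallumLMS1991, §4 (4)–(6), Lemma 4.6] -/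
theorem pow_zsmul_kolyvaginClass_ne_zero_of_levelUp (W : WeierstrassCurve ℚ) [W.IsElliptic] [W.IsGloballyMinimal]
    (hsur : ∀ m : ℕ, W.HasSurjectiveModNGaloisRep (2 ^ m : ℕ))
    (K : Type) [Field K] [NumberField K] (hK : IsImaginaryQuadratic K) (hne3 : NumberField.discr K ≠ -3)
    (hne4 : NumberField.discr K ≠ -4) (h2d : ¬ ((2 : ℤ) ∣ NumberField.discr K)) [NeZero (W.conductorNorm ℤ)]
    (hHN : SatisfiesHeegnerHypothesis (W.conductorNorm ℤ) K)
    (Dt : ModularParametrizationData W (W.conductorNorm ℤ)) (β : ℤ) (ι : K →+* ℂ)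
    (n : ℕ) (dat : KolyvaginHeegnerData Dt β ι n) (M i j : ℕ)
    (hn : KolyvaginDescent.KolSupp (Zhang2014.IsKolyvaginPrime (W.conductorNorm ℤ) W K 2) n)
    (hlev : ((M + j : ℕ) : ℕ∞) ≤ Zhang2014.levelIndex W 2 n)
    (hne : ((2 ^ (i + j) : ℕ) : ℤ) • dat.kolyvaginClass Nat.prime_two (M + j) ≠ 0) :
    ((2 ^ i : ℕ) : ℤ) • dat.kolyvaginClass Nat.prime_two M ≠ 0 := by
  induction j generalizing i with
  | zero => simpa using hne
  | succ j ih =>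
    -- `M + (j + 1)` and `M + j + 1` (likewise for `i`) agree definitionally
    have hlev' : ((M + j + 1 : ℕ) : ℕ∞) ≤ Zhang2014.levelIndex W 2 n := hlev
    have hne' : ((2 ^ (i + j + 1) : ℕ) : ℤ) • dat.kolyvaginClass Nat.prime_two (M + j + 1) ≠ 0 := hne
    have h1 := KolyvaginLowerBoundAtTwo.globalOrderLevelDownAtTwo W hsur K hK hne3 hne4 h2d hHN Dt β ι n dat
      (M + j) (i + j) hn hlev' hne'
    have hlevj : ((M + j : ℕ) : ℕ∞) ≤ Zhang2014.levelIndex W 2 n :=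
      le_trans (by exact_mod_cast Nat.le_succ (M + j)) hlev'
    exact ih i hlevj h1

/-! ## §2 U1 ⟹ S0⁺ (deep seed) and S0⁺ ⟺ U1 -/

/-- **U1 ⟹ S0⁺ `DeepSeedAtTwo`** (level reduction): with the crux's `(r, m)` put `M₁ := m + 1`; for `M* ≥ M₁` the crux at level `M*`
gives a depth-`r` conductor `n` with `M* ≤ M(n)` and `2^(M*−m−1)·c_{M*}(n) ≠ 0`, and `M* − M₁` downward level links give `c_{M₁}(n) ≠ 0`.
HONEST: both sides OPEN; this is the converse of the tree's `boundedDefect_of_deepSeed`; nothing is proved about BSD.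
[cite: McCallumLMS1991, §4 (4)–(6), Lemma 4.6] [cite: Kolyvagin1991MathAnn, §2 (2.1)] -/
theorem deepSeed_of_boundedDefect (h : KolyvaginBoundedDefectAtTwo) : DeepSeedAtTwo := by
  intro W _ _ hCM hred hsur K _ _ hK _ hHN hodd hne3 htor hH2 Dt β ι hβ
  obtain ⟨r, m, hU⟩ := h W hCM hred hsur K hK hHN hodd hne3 htor hH2 Dt β ι hβ
  refine ⟨r, m + 1, by omega, fun Mstar hM ↦ ?_⟩
  obtain ⟨n, d, hn, hr, hlev, hne⟩ := hU Mstar (by omega)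
  refine ⟨n, d, hn, hr, hlev, ?_⟩
  obtain ⟨j, rfl⟩ : ∃ j, Mstar = m + 1 + j := ⟨Mstar - (m + 1), by omega⟩
  have hne4 : NumberField.discr K ≠ -4 := fun h4 ↦ by
    rw [h4] at hodd; exact (Int.not_even_iff_odd.mpr hodd) ⟨-2, by norm_num⟩
  have h2d : ¬ ((2 : ℤ) ∣ NumberField.discr K) := fun h2 ↦
    Int.not_even_iff_odd.mpr hodd (even_iff_two_dvd.mpr h2)
  have hne' : ((2 ^ (0 + j) : ℕ) : ℤ) • d.kolyvaginClass Nat.prime_two (m + 1 + j) ≠ 0 := by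
    have e : m + 1 + j - m - 1 = j := by omega
    rw [e] at hne
    simpa only [zero_add, Nat.cast_pow, Nat.cast_ofNat] using hne
  have h0 := pow_zsmul_kolyvaginClass_ne_zero_of_levelUp W hsur K hK hne3 hne4 h2d hHN Dt β ι n d (m + 1) 0 j hn hlev hne'
  rwa [pow_zero, Nat.cast_one, one_zsmul] at h0

/-- **S0⁺ ⟺ U1** in the kernel: `DeepSeedAtTwo ↔ KolyvaginBoundedDefectAtTwo` (the Defs file's «a READING of the crux, not a
weakening», now a theorem: `boundedDefect_of_deepSeed` ∧ `deepSeed_of_boundedDefect`).  Both sides OPEN; BSD is not proved.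
[cite: McCallumLMS1991, §4 Cor. 4.5, Lemma 4.6] -/
theorem deepSeedAtTwo_iff_boundedDefect : DeepSeedAtTwo ↔ KolyvaginBoundedDefectAtTwo :=
  ⟨boundedDefect_of_deepSeed, deepSeed_of_boundedDefect⟩

/-! ## §3 U1 ⟹ S0ʳ (room seed) and S0ʳ ⟺ U1 modulo P372 -/

/-- **U1 ⟹ S0ʳ `KolyvaginRoomSeedAtTwo`** (the phantom line costs ONE bit): with the crux's `(r, m)` and a room `k`, at level
`M := m + k + 2` the crux gives a depth-`r` conductor `n`, `M ≤ M(n)`, with `2^(k+1)·c_M(n) ≠ 0`; were `2^k·[c_M(n), ρ] = 0` for all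
`ρ ∈ Γ_{K(E[2^M])}`, the class `2^k·c_M(n)` would vanish on `Γ_{K(E[2^M])}` and Sah's one-bit inflation defect on the habitat
(`KolyvaginLowerBoundAtTwo.inflationDefect_one_of_hasSurjectiveModNGaloisRep`, `M' = M`) would give `2·2^k·c_M(n) = 0`.  So `c_M(n)` has
VISIBLE order `> 2^k`.  HONEST: both sides OPEN; converse of the line's composition (which needs P372); BSD is not proved.
[cite: Sah1968, Prop. 2.7 (b)] [cite: GrossLMS1991, §9 (pairing after Prop. 9.1)] [cite: Kolyvagin1991MathAnn, §2, Conj. 2.5 and the k(r) remark] -/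
theorem roomSeed_of_boundedDefect (h : KolyvaginBoundedDefectAtTwo) : KolyvaginRoomSeedAtTwo := by
  intro W _ _ hCM hred hsur K _ _ hK _ hHN hodd hne3 htor hH2 Dt β ι hβ
  obtain ⟨r, m, hU⟩ := h W hCM hred hsur K hK hHN hodd hne3 htor hH2 Dt β ι hβ
  refine ⟨r, fun k ↦ ?_⟩
  obtain ⟨n, d, hn, hr, hlev, hne⟩ := hU (m + k + 2) (by omega)
  refine ⟨n, d, m + k + 2, hn, hr, by omega, hlev, ?_⟩
  by_contra hall
  push Not at hall
  have hx : ∀ ρ ∈ torsionFixing (W.baseChange K) ((2 ^ (m + k + 2) : ℕ) : ℤ),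
      h1Eval (W.baseChange K) ((2 ^ (m + k + 2) : ℕ) : ℤ)
        (((2 ^ k : ℕ) : ℤ) • d.kolyvaginClass Nat.prime_two (m + k + 2)) ρ = 0 := fun ρ hρ ↦ by
    rw [h1Eval_zsmul _ _ _ _ hρ]
    exact hall ρ hρ
  have h2 := KolyvaginLowerBoundAtTwo.inflationDefect_one_of_hasSurjectiveModNGaloisRep W hK.1
    (M := m + k + 2) (M' := m + k + 2) (by omega) le_rfl (hsur _) _ hx
  apply hne
  have e : m + k + 2 - m - 1 = k + 1 := by omega
  rw [e, pow_succ' (2 : ℤ) k, ← smul_smul]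
  simpa only [pow_one, Nat.cast_pow, Nat.cast_ofNat] using h2

/-- **S0⁺ ⟹ S0ʳ** (composition through U1: `boundedDefect_of_deepSeed`, then `roomSeed_of_boundedDefect`).  Both OPEN; BSD not proved.
[cite: Kolyvagin1991MathAnn, §2 (2.1), Conj. 2.5] -/
theorem roomSeed_of_deepSeed (h : DeepSeedAtTwo) : KolyvaginRoomSeedAtTwo :=
  roomSeed_of_boundedDefect (boundedDefect_of_deepSeed h)

/-- **S0ʳ ⟺ U1 modulo P372**: `KolyvaginRoomSeedAtTwo ↔ KolyvaginBoundedDefectAtTwo` given Gross 1991 Prop. 3.7 (2)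
(`h37`, named Literature fact, unproved in the tree; it enters ONLY through the forward arrow, LINE 17's swap composition
`kolyvaginBoundedDefectAtTwo_of_roomSeed_of_frobeniusCongruence`; the backward arrow `roomSeed_of_boundedDefect` is unconditional).
CONDITIONAL on `h37`; both sides OPEN; closes nothing; BSD is NOT proved. [cite: GrossLMS1991, §3 Prop. 3.7 (2), §9]
[cite: Kolyvagin1991MathAnn, §2 (2.1), Conj. 2.5 and the k(r) remark] -/
theorem roomSeedAtTwo_iff_boundedDefect_of_frobeniusCongruence
    (h37 : Literature.NumberTheory.EllipticCurves.GrossLMS1991.prop37_2_frobeniusCongruence) :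
    KolyvaginRoomSeedAtTwo ↔ KolyvaginBoundedDefectAtTwo :=
  ⟨fun hS ↦ kolyvaginBoundedDefectAtTwo_of_roomSeed_of_frobeniusCongruence hS h37, roomSeed_of_boundedDefect⟩

/-- **S0ʳ ⟺ S0⁺ modulo P372** (the line's two obligation nodes are one statement modulo the print fact).  CONDITIONAL on `h37`;
both OPEN; BSD not proved. [cite: GrossLMS1991, §3 Prop. 3.7 (2)] [cite: Kolyvagin1991MathAnn, §2 Conj. 2.5] -/
theorem roomSeedAtTwo_iff_deepSeedAtTwo_of_frobeniusCongruence
    (h37 : Literature.NumberTheory.EllipticCurves.GrossLMS1991.prop37_2_frobeniusCongruence) :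
    KolyvaginRoomSeedAtTwo ↔ DeepSeedAtTwo :=
  (roomSeedAtTwo_iff_boundedDefect_of_frobeniusCongruence h37).trans deepSeedAtTwo_iff_boundedDefect.symm

end Summit.BirchSwinnertonDyer.BirchSwinnertonDyer.Theorems.KolyvaginAtTwo.KolyvaginSwap

end
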